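import Mathlib
import HarnessLib
import Summits.KontsevichZagierPeriods.KontsevichZagierPeriods.Theorems.LinRedNormalFormDihedralNormalFormStubAtomReductionAux4

/-!
# Tool stub `atomConvergence` (line `torus-descent-sum-shadow`, crux `DihedralNormalForm`), part I:
when is a chordal weight integrable on the open cube?

Registered sub-goal of this file: `atomConvergence_weightIff`.

In the picture `v = 1 - x` of the open cube `(0,1)ⁿ⁺¹` consider the weight
`W(v) = ∏ₗ (1 - vₗ)^{dₗ} · ∏ₐ (1 - ∏_{l ∈ Iₐ} (1 - vₗ))^{γₐ}` (`d ∈ ℕ`, `γ ∈ ℤ`, the `Iₐ` non-empty sets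
of coordinates). We prove the **convergence criterion in sector form**
(`integrableOn_weightV_iff`): `W` is absolutely integrable on the open cube iff for every order
sector `v_{π 0} > v_{π 1} > ⋯ > v_{π n}` and every `i`,

  `0 ≤ (n - i) + ∑ {γₐ | Iₐ ⊆ π {i, …, n}}`.

Proof. The sectors cover the cube up to a null set (tools II of `stub_atomReduction`); in the
nested chart `v_{π j} = y₀ ⋯ yⱼ` of a sector every chord `1 - ∏_{l ∈ I} (1 - vₗ)` is squeezed
between `v_{π j(I)}` and `|I| · v_{π j(I)}` (`j(I) = min π⁻¹ I`), so `W · Jacobian` is squeezed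
between constant multiples of the Laurent monomial `y^D`,
`Dᵢ = (n - i) + ∑ {γₐ | i ≤ j(Iₐ)}` (`chart_bounds`; the lower bound on the half box `y₀ < ½`,
where the factors `(1 - vₗ)^{dₗ}` are units). Sufficiency is then monomial integrability
(`integrableOn_prod_zpow`, tools I); necessity is the lowest-power lemma of tools I for the
constant polynomial (`neg_one_lt_of_integrableOn_prod_zpow`).

Recurring terms are written through parse-time notations (`SEC⟪⟫`, `NC⟪⟫`, `CHORD⟪⟫`, `WEIGHT⟪⟫`,
`EXPO⟪⟫`); the file introduces no definitions.
-/

noncomputable section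

open MeasureTheory Set MvPolynomial Filter Topology

namespace Summit.KontsevichZagierPeriods.DihedralNormalForm.TorusDescent.AtomConvergence

open Summit.KontsevichZagierPeriods.MzvKernelInKZ
open Summit.KontsevichZagierPeriods.DihedralNormalForm.TorusDescent.AtomReduction

/-! ### Notation (parse-time abbreviations; no definitions are introduced) -/

set_option quotPrecheck false

local notation "SEC⟪" k ", " π "⟫" =>
  ({v : Fin k → ℝ | (∀ i, v i ∈ Set.Ioo (0:ℝ) 1) ∧ StrictAnti fun j => v (π j)} : Set (Fin k → ℝ))
local notation "NC⟪" k ", " π ", " y "⟫" =>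
  (Summit.KontsevichZagierPeriods.MzvKernelInKZ.TwoPosets.cubicalMap k y ∘ (Equiv.symm π))
local notation "CHORD⟪" I ", " v "⟫" => ((1:ℝ) - ∏ l ∈ I, (1 - v l))
local notation "WEIGHT⟪" I ", " γ ", " d ", " v "⟫" =>
  ((∏ l, (1 - v l) ^ (d l : ℕ)) * ∏ a, CHORD⟪I a, v⟫ ^ (γ a : ℤ))
/-- The exponent of `yᵢ` in `W ∘ (nested chart of π) · Jacobian`:
`(n - i) + ∑ {γₐ | Iₐ ⊆ π {i, …, n}}`. -/
local notation "EXPO⟪" n ", " I ", " γ ", " π ", " i "⟫" =>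
  (((n + 1 - 1 - (i : ℕ) : ℕ) : ℤ) +
    ∑ a ∈ Finset.univ.filter (fun a => ∀ l ∈ I a, i ≤ (Equiv.symm π) l), (γ a : ℤ))

set_option quotPrecheck true

variable {n : ℕ} {ι : Type*} [Fintype ι]

/-! ### Monomials: the necessary direction -/

omit [Fintype ι] in
/-- If the Laurent monomial `∏ₗ yₗ^{Γₗ}` is integrable on the box `(0, t)ⁿ⁺¹`, then every exponent
exceeds `-1` (the lowest-power lemma of tools I for the constant polynomial `1`). -/
theorem neg_one_lt_of_integrableOn_prod_zpow (Γ : Fin (n + 1) → ℤ) {t : ℝ} (ht : 0 < t)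
    (h : IntegrableOn (fun y : Fin (n + 1) → ℝ => ∏ l, y l ^ Γ l)
      (Set.pi univ fun _ : Fin (n + 1) => Ioo (0:ℝ) t)) (i : Fin (n + 1)) : -1 < Γ i := by
  have h1 : IntegrableOn (fun y : Fin (n + 1) → ℝ =>
      |eval y (1 : MvPolynomial (Fin (n + 1)) ℝ)| * ∏ l, y l ^ Γ l)
      (Set.pi univ fun _ : Fin (n + 1) => Ioo (0:ℝ) t) :=
    h.congr_fun (fun y _ => by simp) (MeasurableSet.univ_pi fun _ => measurableSet_Ioo)
  have h0 : (0 : Fin (n + 1) →₀ ℕ) ∈ (1 : MvPolynomial (Fin (n + 1)) ℝ).support := by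
    rw [MvPolynomial.support_one]
    exact Finset.mem_singleton_self 0
  have := neg_one_lt_of_integrableOn_abs_eval_mul 1 Γ ht h1 0 h0 i
  simpa using this

/-! ### The two-sided estimate along the nested chart of a sector -/

/-- **Chart bounds.** Along the nested chart `v_{π j} = y₀ ⋯ yⱼ` of the sector of `π`, the weight
times the Jacobian is non-negative, bounded above on the open cube by `K · y^D`, and bounded below
on the half box `y₀ < ½` by `κ · y^D`, where `Dᵢ = EXPO⟪n, I, γ, π, i⟫`. -/
theorem chart_bounds (I : ι → Finset (Fin (n + 1))) (hI : ∀ a, (I a).Nonempty) (γ : ι → ℤ)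
    (d : Fin (n + 1) → ℕ) (π : Equiv.Perm (Fin (n + 1))) :
    ∃ κ K : ℝ, 0 < κ ∧ 0 < K ∧ ∀ y : Fin (n + 1) → ℝ, (∀ i, y i ∈ Ioo (0:ℝ) 1) →
      0 ≤ WEIGHT⟪I, γ, d, (NC⟪(n + 1), π, y⟫)⟫ * ∏ j, y j ^ (n + 1 - 1 - (j : ℕ)) ∧
      WEIGHT⟪I, γ, d, (NC⟪(n + 1), π, y⟫)⟫ * ∏ j, y j ^ (n + 1 - 1 - (j : ℕ)) ≤
        K * ∏ i, y i ^ EXPO⟪n, I, γ, π, i⟫ ∧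
      (y 0 < 1 / 2 → κ * ∏ i, y i ^ EXPO⟪n, I, γ, π, i⟫ ≤
        WEIGHT⟪I, γ, d, (NC⟪(n + 1), π, y⟫)⟫ * ∏ j, y j ^ (n + 1 - 1 - (j : ℕ))) := by
  classical
  -- data of the sector (adapted from `integrableOn_monomial_mul_weightV`, tools IV)
  set jI : ι → Fin (n + 1) := fun a => ((I a).image π.symm).min' ((hI a).image _) with hjI
  have hfilter : ∀ i : Fin (n + 1),
      Finset.univ.filter (fun a => ∀ l ∈ I a, i ≤ π.symm l) =
        Finset.univ.filter (fun a => i ≤ jI a) := by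
    intro i
    refine Finset.filter_congr fun a _ => ?_
    rw [hjI, Finset.le_min'_iff]
    simp only [Finset.mem_image, forall_exists_index, and_imp, forall_apply_eq_imp_iff₂]
  set E : Fin (n + 1) → ℤ := fun i => ∑ a ∈ Finset.univ.filter (fun a => i ≤ jI a), γ a with hE
  have hΓ : ∀ i : Fin (n + 1), EXPO⟪n, I, γ, π, i⟫ = ((n + 1 - 1 - (i : ℕ) : ℕ) : ℤ) + E i := by
    intro i
    rw [hfilter i]
  set cst : ι → ℝ := fun a => ((I a).card : ℝ) ^ (γ a).natAbs with hcst
  set Kup : ℝ := ∏ a, cst a with hKup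
  set κ₁ : ℝ := ∏ l : Fin (n + 1), (1 / 2 : ℝ) ^ d l with hκ₁
  have hcst1 : ∀ a, 1 ≤ cst a := fun a =>
    one_le_pow₀ (by exact_mod_cast (hI a).card_pos)
  have hcst0 : ∀ a, 0 < cst a := fun a => one_pos.trans_le (hcst1 a)
  have hKup0 : 0 < Kup := Finset.prod_pos fun a _ => hcst0 a
  have hKupinv : ∏ a, (cst a)⁻¹ = Kup⁻¹ := by rw [hKup, Finset.prod_inv_distrib]
  have hκ₁0 : 0 < κ₁ := Finset.prod_pos fun l _ => pow_pos (by norm_num) _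
  have hπjI : ∀ a, π (jI a) ∈ I a := by
    intro a
    have := Finset.min'_mem ((I a).image π.symm) ((hI a).image _)
    rw [Finset.mem_image] at this
    obtain ⟨l, hl, hl'⟩ := this
    have : π (jI a) = l := by rw [hjI]; simp only; rw [← hl', Equiv.apply_symm_apply]
    rw [this]; exact hl
  have hjIle : ∀ a, ∀ l ∈ I a, jI a ≤ π.symm l := fun a l hl =>
    Finset.min'_le _ _ (Finset.mem_image_of_mem _ hl)
  refine ⟨κ₁ * Kup⁻¹, Kup, mul_pos hκ₁0 (inv_pos.2 hKup0), hKup0, fun y hy => ?_⟩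
  -- facts along the chart
  set v := NC⟪(n + 1), π, y⟫ with hv_def
  obtain ⟨hv, hanti⟩ := nestedChart_mem_sector π hy
  have hmono := hanti.antitone
  have hv01 : ∀ l, 0 ≤ v l ∧ v l ≤ 1 := fun l => ⟨(hv l).1.le, (hv l).2.le⟩
  have hy0 : ∀ i, y i ≠ 0 := fun i => (hy i).1.ne'
  have hy0' : ∀ i, 0 < y i := fun i => (hy i).1
  have hvle : ∀ l, v l ≤ y 0 := by
    intro l
    have h1 : v l = v (π (π.symm l)) := by rw [Equiv.apply_symm_apply]
    have h2 : v (π (π.symm l)) ≤ v (π 0) := hmono (Fin.zero_le _)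
    have h3 : v (π 0) = y 0 := by
      rw [hv_def, nestedChart_apply_perm]
      have : Finset.univ.filter (fun i : Fin (n + 1) => i ≤ 0) = {0} := by
        ext i; simp
      rw [this, Finset.prod_singleton]
    linarith
  have hch : ∀ a, (cst a)⁻¹ * (v (π (jI a))) ^ γ a ≤ CHORD⟪(I a), v⟫ ^ γ a ∧
      CHORD⟪(I a), v⟫ ^ γ a ≤ cst a * (v (π (jI a))) ^ γ a := by
    intro a
    have hY : 0 < v (π (jI a)) := (hv _).1
    have hlow : v (π (jI a)) ≤ CHORD⟪(I a), v⟫ := le_chordV hv01 (hπjI a)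
    have hup : CHORD⟪(I a), v⟫ ≤ (I a).card * v (π (jI a)) := by
      refine (chordV_le_sum hv01).trans ?_
      have : ∀ l ∈ I a, v l ≤ v (π (jI a)) := fun l hl => by
        have h1 : v l = v (π (π.symm l)) := by rw [Equiv.apply_symm_apply]
        rw [h1]; exact hmono (hjIle a l hl)
      calc ∑ l ∈ I a, v l ≤ ∑ _l ∈ I a, v (π (jI a)) := Finset.sum_le_sum this
        _ = (I a).card * v (π (jI a)) := by rw [Finset.sum_const, nsmul_eq_mul]
    have hc1 : (1 : ℝ) ≤ (I a).card := by exact_mod_cast (hI a).card_pos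
    exact zpow_two_sided hY hlow hup hc1 (γ a)
  have hexp : (∏ a, (v (π (jI a))) ^ γ a) * ∏ j, y j ^ (n + 1 - 1 - (j : ℕ)) =
      ∏ i, y i ^ EXPO⟪n, I, γ, π, i⟫ := by
    have h1 : ∏ a, (v (π (jI a))) ^ γ a = ∏ i, y i ^ E i := by
      simp only [hv_def, nestedChart_apply_perm]
      exact prod_pprod_zpow jI γ y hy0
    rw [h1, ← Finset.prod_mul_distrib]
    refine Finset.prod_congr rfl fun i _ => ?_
    rw [hΓ i, zpow_add₀ (hy0 i), zpow_natCast, mul_comm]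
  have hJ : 0 ≤ ∏ j : Fin (n + 1), y j ^ (n + 1 - 1 - (j : ℕ)) :=
    Finset.prod_nonneg fun j _ => pow_nonneg (hy0' j).le _
  have hW0 : 0 ≤ WEIGHT⟪I, γ, d, v⟫ := weightV_nonneg I hI γ d hv
  have hch0 : ∀ a, 0 ≤ CHORD⟪(I a), v⟫ ^ γ a := fun a =>
    (zpow_pos ((hv _).1.trans_le (le_chordV hv01 (hπjI a))) _).le
  refine ⟨mul_nonneg hW0 hJ, ?_, fun hyhalf => ?_⟩
  · -- the upper bound on the cube
    have h1le : ∏ l, (1 - v l) ^ d l ≤ 1 :=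
      Finset.prod_le_one (fun l _ => pow_nonneg (by linarith [(hv l).2]) _)
        fun l _ => pow_le_one₀ (by linarith [(hv l).2]) (by linarith [(hv l).1])
    have hwv : WEIGHT⟪I, γ, d, v⟫ ≤ Kup * ∏ a, (v (π (jI a))) ^ γ a := by
      calc (∏ l, (1 - v l) ^ d l) * ∏ a, CHORD⟪(I a), v⟫ ^ γ a
          ≤ 1 * ∏ a, (cst a * (v (π (jI a))) ^ γ a) :=
            mul_le_mul h1le (Finset.prod_le_prod (fun a _ => hch0 a) fun a _ => (hch a).2)
              (Finset.prod_nonneg fun a _ => hch0 a) zero_le_one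
        _ = Kup * ∏ a, (v (π (jI a))) ^ γ a := by rw [one_mul, Finset.prod_mul_distrib]
    calc WEIGHT⟪I, γ, d, v⟫ * ∏ j, y j ^ (n + 1 - 1 - (j : ℕ))
        ≤ (Kup * ∏ a, (v (π (jI a))) ^ γ a) * ∏ j, y j ^ (n + 1 - 1 - (j : ℕ)) :=
          mul_le_mul_of_nonneg_right hwv hJ
      _ = Kup * ∏ i, y i ^ EXPO⟪n, I, γ, π, i⟫ := by rw [mul_assoc, hexp]
  · -- the lower bound on the half box
    have hw1 : κ₁ ≤ ∏ l, (1 - v l) ^ d l := by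
      refine Finset.prod_le_prod (fun l _ => pow_nonneg (by norm_num) _) fun l _ => ?_
      exact pow_le_pow_left₀ (by norm_num) (by linarith [hvle l]) _
    have hw2 : Kup⁻¹ * ∏ a, (v (π (jI a))) ^ γ a ≤ ∏ a, CHORD⟪(I a), v⟫ ^ γ a := by
      rw [← hKupinv, ← Finset.prod_mul_distrib]
      exact Finset.prod_le_prod (fun a _ => mul_nonneg (inv_nonneg.2 (hcst0 a).le)
        (zpow_pos (hv _).1 _).le) fun a _ => (hch a).1
    have hwv : κ₁ * (Kup⁻¹ * ∏ a, (v (π (jI a))) ^ γ a) ≤ WEIGHT⟪I, γ, d, v⟫ :=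
      mul_le_mul hw1 hw2 (mul_nonneg (inv_nonneg.2 hKup0.le)
        (Finset.prod_nonneg fun a _ => (zpow_pos (hv _).1 _).le))
        (Finset.prod_nonneg fun l _ => pow_nonneg (by linarith [(hv l).2]) _)
    calc κ₁ * Kup⁻¹ * ∏ i, y i ^ EXPO⟪n, I, γ, π, i⟫
        = κ₁ * (Kup⁻¹ * ∏ a, (v (π (jI a))) ^ γ a) * ∏ j, y j ^ (n + 1 - 1 - (j : ℕ)) := by
          rw [← hexp]; ring
      _ ≤ WEIGHT⟪I, γ, d, v⟫ * ∏ j, y j ^ (n + 1 - 1 - (j : ℕ)) :=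
          mul_le_mul_of_nonneg_right hwv hJ

/-! ### The criterion in sector form -/

/-- **Convergence criterion, sector form.** The weight `W` is integrable on the open cube iff
`0 ≤ (n - i) + ∑ {γₐ | Iₐ ⊆ π {i, …, n}}` for every permutation `π` and every `i`. -/
theorem integrableOn_weightV_iff (I : ι → Finset (Fin (n + 1))) (hI : ∀ a, (I a).Nonempty)
    (γ : ι → ℤ) (d : Fin (n + 1) → ℕ) :
    IntegrableOn (fun v => WEIGHT⟪I, γ, d, v⟫) {x : Fin (n + 1) → ℝ | ∀ i, x i ∈ Ioo (0:ℝ) 1} ↔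
      ∀ (π : Equiv.Perm (Fin (n + 1))) (i : Fin (n + 1)), 0 ≤ EXPO⟪n, I, γ, π, i⟫ := by
  constructor
  · intro h π i
    obtain ⟨κ, K, hκ, -, hb⟩ := chart_bounds I hI γ d π
    have hH := (integrableOn_sector_iff π _).1 (integrableOn_sector_of_cube h π)
    have hbox : (Set.pi univ fun _ : Fin (n + 1) => Ioo (0:ℝ) (1 / 2)) ⊆
        {x : Fin (n + 1) → ℝ | ∀ i, x i ∈ Ioo (0:ℝ) 1} := fun y hy i =>
      ⟨(hy i (mem_univ _)).1, (hy i (mem_univ _)).2.trans (by norm_num)⟩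
    have hM : IntegrableOn (fun y : Fin (n + 1) → ℝ => ∏ i, y i ^ EXPO⟪n, I, γ, π, i⟫)
        (Set.pi univ fun _ : Fin (n + 1) => Ioo (0:ℝ) (1 / 2)) := by
      have h1 := ((hH.mono_set hbox).norm).const_mul κ⁻¹
      refine Integrable.mono' h1 ?_ ?_
      · exact (Finset.measurable_prod _ fun l _ =>
          (measurable_pi_apply l).pow_const _).aestronglyMeasurable
      · refine ae_restrict_of_forall_mem (MeasurableSet.univ_pi fun _ => measurableSet_Ioo)
          fun y hy => ?_
        have hy' : ∀ i, y i ∈ Ioo (0:ℝ) 1 := hbox hy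
        obtain ⟨h0, -, hlow⟩ := hb y hy'
        have hl := hlow (hy 0 (mem_univ _)).2
        have hM0 : 0 ≤ ∏ i, y i ^ EXPO⟪n, I, γ, π, i⟫ :=
          Finset.prod_nonneg fun i _ => (zpow_pos (hy' i).1 _).le
        rw [Real.norm_of_nonneg hM0, Real.norm_of_nonneg h0]
        calc ∏ i, y i ^ EXPO⟪n, I, γ, π, i⟫
            = κ⁻¹ * (κ * ∏ i, y i ^ EXPO⟪n, I, γ, π, i⟫) := by field_simp
          _ ≤ _ := mul_le_mul_of_nonneg_left hl (inv_nonneg.2 hκ.le)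
    have := neg_one_lt_of_integrableOn_prod_zpow _ (by norm_num) hM i
    omega
  · intro h
    apply integrableOn_cube_of_forall_sector
    intro π
    rw [integrableOn_sector_iff]
    obtain ⟨_, K, -, -, hb⟩ := chart_bounds I hI γ d π
    have hM := integrableOn_prod_zpow (fun i => EXPO⟪n, I, γ, π, i⟫) fun i => by
      have := h π i
      omega
    refine Integrable.mono' (hM.const_mul K) ?_ ?_
    · refine Measurable.aestronglyMeasurable ?_
      exact (((measurable_weightV I γ d).comp (measurable_nestedChart π))).mul
        (Finset.measurable_prod _ fun j _ => (measurable_pi_apply j).pow_const _)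
    · refine ae_restrict_of_forall_mem (measurableSet_cube (n + 1)) fun y hy => ?_
      obtain ⟨h0, hup, -⟩ := hb y hy
      rw [Real.norm_of_nonneg h0]
      exact hup

/-- **Registered sub-goal `atomConvergence_weightIff`** (tool stub `atomConvergence`, part I): the
convergence criterion for chordal weights in sector form. -/
theorem atomConvergence_weightIff : ∀ (n : ℕ) (ι : Type) [Fintype ι] (I : ι → Finset (Fin (n + 1))), (∀ a, (I a).Nonempty) → ∀ (γ : ι → ℤ) (d : Fin (n + 1) → ℕ), (MeasureTheory.IntegrableOn (fun v : Fin (n + 1) → ℝ => (∏ l, (1 - v l) ^ d l) * ∏ a, (1 - ∏ l ∈ I a, (1 - v l)) ^ γ a) {x : Fin (n + 1) → ℝ | ∀ i, x i ∈ Set.Ioo (0:ℝ) 1} MeasureTheory.volume ↔ ∀ (π : Equiv.Perm (Fin (n + 1))) (i : Fin (n + 1)), 0 ≤ ((n + 1 - 1 - (i : ℕ) : ℕ) : ℤ) + ∑ a ∈ Finset.univ.filter (fun a => ∀ l ∈ I a, i ≤ π.symm l), γ a) :=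
  fun _ _ _ I hI γ d => integrableOn_weightV_iff I hI γ d

end Summit.KontsevichZagierPeriods.DihedralNormalForm.TorusDescent.AtomConvergence
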